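import Mathlib
import Literature.Analysis.FluidPDE.VectorCalculus
import Summits.NavierStokesRegularity.NavierStokesRegularity.Theorems.UnthreadedDoorFluxStarvedDipoleLatitudeIdentity
import Summits.NavierStokesRegularity.NavierStokesRegularity.Theorems.UnthreadedDoorFluxStarvedDipoleAmplitudeLaw
import Summits.NavierStokesRegularity.NavierStokesRegularity.Theorems.UnthreadedDoorFluxStarvedDipoleTangencyOfZeroFlux
import Summits.NavierStokesRegularity.NavierStokesRegularity.Theorems.UnthreadedDoorFluxStarvedDipoleZeroNetFlux
import HarnessLib

/-!
# Route `UnthreadedDoor`, crux `PoloidalLiouville` (stmt-NavierStokesRegularity-1222), wall W1 — crux idea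
# «flux-starved-dipoles» (ns-idea-15 g12/g13, `Cruxes/PoloidalLiouville/FluxStarvedDipoleSketch.lean`):
# `FluxStarvationSteady` PROVED, hence K1 `DipoleNeverSteady` and `AmplitudeLawSteady` UNCONDITIONAL

The crux card's K1 («no steady toroidal dipole `B = A(r) × (x − x₀)` is maintained on `ℝ³` by any `C¹` incompressible drift»)
was reduced in the kernel (p836018 `convexEndgame`, p836154, p837099, p837161) to the single typed Prop `FluxStarvationSteady`,
whose inputs landed as p837304 (loop laws), p837414 (tangency from constant loop momentum + zero flux), p837567 (zero net flux
through spheres) and `…FluxStarvedDipoleLatitudeIdentity` (the latitude-independence identity ★).  THIS FILE assembles them: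

* `fluxStarvationSteady` — the sketch Prop `FluxStarvationSteady` VERBATIM (unfolded): at a non-solid radius
  (`A(r) ≠ 0`, `r(‖A‖)′(r) ≠ ‖A(r)‖`; `(‖A‖)′ = ⟪A′, Â⟫` by `deriv_norm_eq_inner_unit`) ★ gives the same loop momentum
  `−r³⟪Cv,n⟫/(a − r a′)` on every non-polar latitude circle, hence on the whole sphere (continuity in the colatitude; every point
  of `S_r(x₀)` is `x₀ + r cos θ·n + r sin θ·e` with `e ⊥ n`), and zero net flux makes it `0`;
* `amplitudeLawSteady`, `dipoleNeverSteady` — the sketch Props `AmplitudeLawSteady` and K1 `DipoleNeverSteady` VERBATIM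
  (unfolded), now UNCONDITIONAL, by `amplitudeLawSteady_of_fluxStarvationSteady` / `dipoleNeverSteady_of_fluxStarvationSteady`
  (p837161).

So the K1 record of the crux card is closed in the kernel: every decl of its composition
`FluxStarvationSteady → AmplitudeLawSteady → ConvexEndgame → DipoleNeverSteady` is a theorem.  HONEST LABEL: this is the dipole
(`l = 1`) stratum of the LINEAR kinematic shadow of W1 (critic V28: information-grade, W1 movement 0): it says where a kinematic
toroidal equilibrium cannot live, not that none exists; `PoloidalLiouville` (1222), its wall `stub_scalarLiouville`
(⟺ the crux, ⟸ `LiouvilleConjectureNS`) and the summit stay OPEN; NO Navier–Stokes regularity statement is proved.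
`--supports stmt-NavierStokesRegularity-1222` (helper).  [folklore]
-/

noncomputable section

-- the summit and its single sub-problem share the name (CONVENTIONS §1)
set_option linter.dupNamespace false

open Set Filter Topology InnerProductSpace
open scoped RealInnerProductSpace Laplacian
open Literature.Analysis.FluidPDE
open Summit.NavierStokesRegularity.NavierStokesRegularity.Theorems.PoloidalLiouville.HorizonTower (E3)
open Summit.NavierStokesRegularity.NavierStokesRegularity.Theorems.PoloidalLiouville.KinematicShadow (PointSource.cross_smul_right
  PointSource.cross_add_right PointSource.cross_self PointSource.cross_anticomm)
open Summit.NavierStokesRegularity.NavierStokesRegularity.Theorems.PoloidalLiouville.HorizonTower.Zonal (inner_cross_self_left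
  inner_cross_self_right norm_cross_sq cross_cross_left_of_orthonormal cross_cross_right_of_orthonormal frameBasis
  frameBasis_apply frameVec_zero frameVec_one frameVec_two)

namespace Summit.NavierStokesRegularity.NavierStokesRegularity.Theorems.PoloidalLiouville.FluxStarvedDipole

/-! ### Flux starvation -/

/-- **FLUX STARVATION, steady form** — the sketch Prop `FluxStarvedDipole.FluxStarvationSteady` VERBATIM (with `dipolePotential`,
`IsNonSolidAt`, `SteadyKinematicLawOn` unfolded): a `C¹` incompressible drift `u` maintaining a steady turning-axis dipole
potential `T(x) = ⟪A(‖x−x₀‖), x−x₀⟫/‖x−x₀‖ + R(‖x−x₀‖)` (`A, R ∈ C³(0,∞)`, steady kinematic law off the centre) is TANGENT to every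
non-solid dipolar sphere (`A(r) ≠ 0`, `r(‖A‖)′(r) ≠ ‖A(r)‖`).  Proof: by `latitude_identity` the loop momentum `⟪u, x − x₀⟫` takes
the same value `−r³⟪Cv,n⟫/(a − r a′)` on every non-polar latitude circle of `S_r(x₀)`, hence (continuity in the colatitude) on
all of `S_r(x₀)`; the net flux of `u` through `S_r(x₀)` vanishes (`sphereFlux_eq_zero_of_divFree`), so the constant is `0`
(`tangent_of_loopMomentum_const_of_zeroFlux`). [folklore] -/
theorem fluxStarvationSteady :
    ∀ (u : E3 → E3) (x₀ : E3) (A : ℝ → E3) (R : ℝ → ℝ),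
      ContDiff ℝ 1 u → Literature.Analysis.FluidPDE.VectorCalculus.IsDivFree u →
      ContDiffOn ℝ 3 A (Set.Ioi 0) → ContDiffOn ℝ 3 R (Set.Ioi 0) →
      (∀ x ∈ ({x₀}ᶜ : Set E3),
        cross (gradient (fun z => ⟪u z, gradient (fun x => ⟪A ‖x - x₀‖, x - x₀⟫ / ‖x - x₀‖ + R ‖x - x₀‖) z⟫
            - Δ (fun x => ⟪A ‖x - x₀‖, x - x₀⟫ / ‖x - x₀‖ + R ‖x - x₀‖) z) x) (x - x₀)
          = cross (gradient (fun z => ⟪u z, z - x₀⟫) x)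
              (gradient (fun x => ⟪A ‖x - x₀‖, x - x₀⟫ / ‖x - x₀‖ + R ‖x - x₀‖) x)) →
      ∀ r > 0, (A r ≠ 0 ∧ r * deriv (fun s => ‖A s‖) r ≠ ‖A r‖) →
        ∀ x, ‖x - x₀‖ = r → ⟪u x, x - x₀⟫ = 0 := by
  intro u x₀ A R hu hdiv hA hR hlaw r hr hns
  obtain ⟨hAr, hsol⟩ := hns
  set T : E3 → ℝ := fun x => ⟪A ‖x - x₀‖, x - x₀⟫ / ‖x - x₀‖ + R ‖x - x₀‖ with hTdef
  have hT : ∀ z, T z = ⟪A ‖z - x₀‖, z - x₀⟫ / ‖z - x₀‖ + R ‖z - x₀‖ := fun z => rfl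
  -- the unit axis `n = Â(r)`
  have hAn0 : ‖A r‖ ≠ 0 := norm_ne_zero_iff.mpr hAr
  obtain ⟨n, hn_def⟩ : ∃ n : E3, n = ‖A r‖⁻¹ • A r := ⟨_, rfl⟩
  have hn1 : ‖n‖ = 1 := by rw [hn_def, norm_smul, norm_inv, norm_norm, inv_mul_cancel₀ hAn0]
  have hAn : A r = ‖A r‖ • n := by rw [hn_def, smul_smul, mul_inv_cancel₀ hAn0, one_smul]
  -- the Laplacian of `T` on `S_r` in a radial frame: `ΔT(x₀ + y) = ⟪Cv, y⟫ + D`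
  obtain ⟨b, hb0, -, hb1, hb2⟩ := NetFlux.exists_orthonormalBasis_radial hn1
  obtain ⟨C, D, -, hΔ⟩ := dipole_laplacian_sphere hT hA hR b hr
  obtain ⟨Cv, hCv⟩ : ∃ Cv : E3, Cv = ∑ i, C i • b i := ⟨_, rfl⟩
  have hQ : ∀ y : E3, ‖y‖ = r → Δ T (x₀ + y) = ⟪Cv, y⟫ + D := by
    intro y hy
    rw [hΔ y hy, hCv, sum_inner]
    simp only [real_inner_smul_left, mul_comm]
  -- the derivative of the moment size and the non-solidity defect
  have hA1 : DifferentiableAt ℝ A r := (hA.differentiableOn (by norm_num)).differentiableAt (Ioi_mem_nhds hr)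
  have ha' : deriv (fun s => ‖A s‖) r = ⟪deriv A r, n⟫ := by rw [deriv_norm_eq_inner_unit hA1 hAr, hn_def]
  have hden : ‖A r‖ - r * ⟪deriv A r, n⟫ ≠ 0 := by
    rw [← ha']
    intro h
    exact hsol (by linarith)
  obtain ⟨K, hK⟩ : ∃ K : ℝ, K = -(r ^ 3 * ⟪Cv, n⟫) / (‖A r‖ - r * ⟪deriv A r, n⟫) := ⟨_, rfl⟩
  -- (1) on every NON-POLAR latitude circle the loop momentum equals `K`
  have hlat : ∀ e : E3, ‖e‖ = 1 → ⟪n, e⟫ = 0 → ∀ θ : ℝ, Real.sin θ ≠ 0 →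
      ⟪u (x₀ + ((r * Real.cos θ) • n + (r * Real.sin θ) • e)), (r * Real.cos θ) • n + (r * Real.sin θ) • e⟫ = K := by
    intro e he hne θ hθ
    have h := latitude_identity u x₀ A R hu hdiv hA hR hlaw hr hAr hn1 hAn he hne hQ hθ
    rw [hK, eq_div_iff hden]
    linear_combination h
  -- (2) at the poles too, by continuity in the colatitude
  have hall : ∀ e : E3, ‖e‖ = 1 → ⟪n, e⟫ = 0 → ∀ θ : ℝ,
      ⟪u (x₀ + ((r * Real.cos θ) • n + (r * Real.sin θ) • e)), (r * Real.cos θ) • n + (r * Real.sin θ) • e⟫ = K := by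
    intro e he hne θ
    by_cases hθ : Real.sin θ = 0
    swap
    · exact hlat e he hne θ hθ
    have hy : Continuous fun θ' : ℝ => (r * Real.cos θ') • n + (r * Real.sin θ') • e := by fun_prop
    have hgc : Continuous fun θ' : ℝ =>
        ⟪u (x₀ + ((r * Real.cos θ') • n + (r * Real.sin θ') • e)), (r * Real.cos θ') • n + (r * Real.sin θ') • e⟫ :=
      (hu.continuous.comp (continuous_const.add hy)).inner hy
    have hcos : Real.cos θ ≠ 0 := by
      intro h0
      have h1 := Real.cos_sq_add_sin_sq θ
      rw [h0, hθ] at h1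
      norm_num at h1
    have hev : ∀ᶠ θ' in 𝓝[≠] θ, Real.sin θ' ≠ 0 := (Real.hasDerivAt_sin θ).eventually_ne hcos
    have hev' : ∀ᶠ θ' in 𝓝[≠] θ,
        ⟪u (x₀ + ((r * Real.cos θ') • n + (r * Real.sin θ') • e)), (r * Real.cos θ') • n + (r * Real.sin θ') • e⟫ = K :=
      hev.mono fun θ' h => hlat e he hne θ' h
    have h1 := (hgc.tendsto θ).mono_left (nhdsWithin_le_nhds (s := ({θ}ᶜ : Set ℝ)))
    have h2 : Tendsto (fun θ' : ℝ =>
        ⟪u (x₀ + ((r * Real.cos θ') • n + (r * Real.sin θ') • e)), (r * Real.cos θ') • n + (r * Real.sin θ') • e⟫)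
        (𝓝[≠] θ) (𝓝 K) := (tendsto_congr' hev').mpr tendsto_const_nhds
    exact tendsto_nhds_unique h1 h2
  -- (3) every point of `S_r(x₀)` lies on a latitude circle
  have hconst : ∀ x : E3, ‖x - x₀‖ = r → ⟪u x, x - x₀⟫ = K := by
    intro x hx
    obtain ⟨y, hy⟩ : ∃ y : E3, y = x - x₀ := ⟨_, rfl⟩
    have hyn : ‖y‖ = r := by rw [hy, hx]
    obtain ⟨w, hw⟩ : ∃ w : E3, w = y - ⟪n, y⟫ • n := ⟨_, rfl⟩
    have hnw : ⟪n, w⟫ = 0 := by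
      rw [hw, inner_sub_right, inner_smul_right, real_inner_self_eq_norm_sq, hn1]; ring
    -- a unit vector `e ⊥ n` with `w = ‖w‖ e`
    obtain ⟨e, he, hne, hwe⟩ : ∃ e : E3, ‖e‖ = 1 ∧ ⟪n, e⟫ = 0 ∧ w = ‖w‖ • e := by
      by_cases hw0 : w = 0
      · obtain ⟨e, he, hen⟩ := NetFlux.exists_unit_orth n
        exact ⟨e, he, by rw [real_inner_comm]; exact hen, by rw [hw0, norm_zero, zero_smul]⟩
      · have hw1 : ‖w‖ ≠ 0 := norm_ne_zero_iff.mpr hw0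
        exact ⟨‖w‖⁻¹ • w, by rw [norm_smul, norm_inv, norm_norm, inv_mul_cancel₀ hw1],
          by rw [inner_smul_right, hnw, mul_zero], by rw [smul_smul, mul_inv_cancel₀ hw1, one_smul]⟩
    -- the colatitude `θ = arccos(⟪n, y⟫/r)`
    have hc1 : |⟪n, y⟫ / r| ≤ 1 := by
      rw [abs_div, abs_of_pos hr, div_le_one hr]
      calc |⟪n, y⟫| ≤ ‖n‖ * ‖y‖ := abs_real_inner_le_norm _ _
        _ = r := by rw [hn1, hyn, one_mul]
    obtain ⟨θ, hθ⟩ : ∃ θ : ℝ, θ = Real.arccos (⟪n, y⟫ / r) := ⟨_, rfl⟩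
    have hcos : Real.cos θ = ⟪n, y⟫ / r := by
      rw [hθ]
      exact Real.cos_arccos (abs_le.mp hc1).1 (abs_le.mp hc1).2
    have hw2 : ‖w‖ ^ 2 = r ^ 2 - ⟪n, y⟫ ^ 2 := by
      rw [hw, ← real_inner_self_eq_norm_sq, inner_sub_left, inner_sub_right, inner_sub_right, real_inner_smul_left,
        real_inner_smul_right, real_inner_smul_left, real_inner_smul_right, real_inner_self_eq_norm_sq,
        real_inner_self_eq_norm_sq, hn1, hyn, real_inner_comm y n]
      ring
    have hsin : Real.sin θ = ‖w‖ / r := by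
      rw [hθ, Real.sin_arccos]
      have h3 : 1 - (⟪n, y⟫ / r) ^ 2 = (‖w‖ / r) ^ 2 := by
        rw [div_pow, div_pow, hw2]
        field_simp
      rw [h3, Real.sqrt_sq (div_nonneg (norm_nonneg _) hr.le)]
    have hyeq : y = (r * Real.cos θ) • n + (r * Real.sin θ) • e := by
      rw [hcos, hsin, mul_div_cancel₀ _ hr.ne', mul_div_cancel₀ _ hr.ne', ← hwe, hw, add_sub_cancel]
    have hxeq : x = x₀ + ((r * Real.cos θ) • n + (r * Real.sin θ) • e) := by
      rw [← hyeq, hy, add_sub_cancel]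
    have h := hall e he hne θ
    rw [← hxeq] at h
    rw [← hy, hyeq]
    exact h
  -- (4) zero net flux through `S_r(x₀)` ⇒ the constant is zero
  exact tangent_of_loopMomentum_const_of_zeroFlux u x₀ hr (fun x y hx hy => by rw [hconst x hx, hconst y hy])
    (sphereFlux_eq_zero_of_divFree u hu hdiv x₀ hr)

/-! ### K1 unconditional -/

/-- **AMPLITUDE LAW, unconditional** — the sketch Prop `FluxStarvedDipole.AmplitudeLawSteady` VERBATIM (unfolded): for a `C¹`
incompressible drift maintaining a steady dipole potential (`A, R ∈ C³(0,∞)`, steady kinematic law off the centre), the amplitude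
`w = r‖A(r)‖` is `C²` with `w″ ≥ 2w/r²` wherever `A ≠ 0`.  (`amplitudeLawSteady_of_fluxStarvationSteady`, p837161, fed with
`fluxStarvationSteady`.) [folklore] -/
theorem amplitudeLawSteady :
    ∀ (u : E3 → E3) (x₀ : E3) (A : ℝ → E3) (R : ℝ → ℝ),
      ContDiff ℝ 1 u → Literature.Analysis.FluidPDE.VectorCalculus.IsDivFree u →
      ContDiffOn ℝ 3 A (Set.Ioi 0) → ContDiffOn ℝ 3 R (Set.Ioi 0) →
      (∀ x ∈ ({x₀}ᶜ : Set E3),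
        cross (gradient (fun z => ⟪u z, gradient (fun x => ⟪A ‖x - x₀‖, x - x₀⟫ / ‖x - x₀‖ + R ‖x - x₀‖) z⟫
            - Δ (fun x => ⟪A ‖x - x₀‖, x - x₀⟫ / ‖x - x₀‖ + R ‖x - x₀‖) z) x) (x - x₀)
          = cross (gradient (fun z => ⟪u z, z - x₀⟫) x)
              (gradient (fun x => ⟪A ‖x - x₀‖, x - x₀⟫ / ‖x - x₀‖ + R ‖x - x₀‖) x)) →
      ∀ r > 0, A r ≠ 0 →
        ContDiffAt ℝ 2 (fun r => r * ‖A r‖) r ∧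
          2 * (r * ‖A r‖) / r ^ 2 ≤ iteratedDeriv 2 (fun r => r * ‖A r‖) r :=
  amplitudeLawSteady_of_fluxStarvationSteady fluxStarvationSteady

/-- **K1 — NO STEADY DIPOLE IS MAINTAINED BY ANY INCOMPRESSIBLE DRIFT, unconditional** — the sketch Prop
`FluxStarvedDipole.DipoleNeverSteady` VERBATIM (unfolded): `u ∈ C¹(ℝ³)` divergence-free (no bound), `A, R ∈ C³(0,∞)`, `‖A‖ ≤ C`,
the steady kinematic law `∇(⟪u,∇T⟫ − ΔT) × (x−x₀) = ∇⟪u, x−x₀⟫ × ∇T` off the centre for the turning-axis dipole potential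
`T(x) = ⟪A(‖x−x₀‖), x−x₀⟫/‖x−x₀‖ + R(‖x−x₀‖)` ⇒ `A ≡ 0` on `(0,∞)`: the toroidal dipole `B = A(r) × (x − x₀)` is zero.
(`dipoleNeverSteady_of_fluxStarvationSteady`, p837161, fed with `fluxStarvationSteady`.)  HONEST LABEL: the dipole stratum of the
LINEAR kinematic shadow of W1 (critic V28: information-grade, W1 movement 0); `PoloidalLiouville` (1222), `stub_scalarLiouville` and
the summit stay OPEN. [folklore] -/
theorem dipoleNeverSteady :
    ∀ (u : E3 → E3) (x₀ : E3) (A : ℝ → E3) (R : ℝ → ℝ) (C : ℝ),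
      ContDiff ℝ 1 u → Literature.Analysis.FluidPDE.VectorCalculus.IsDivFree u →
      ContDiffOn ℝ 3 A (Set.Ioi 0) → ContDiffOn ℝ 3 R (Set.Ioi 0) →
      (∀ r > 0, ‖A r‖ ≤ C) →
      (∀ x ∈ ({x₀}ᶜ : Set E3),
        cross (gradient (fun z => ⟪u z, gradient (fun x => ⟪A ‖x - x₀‖, x - x₀⟫ / ‖x - x₀‖ + R ‖x - x₀‖) z⟫
            - Δ (fun x => ⟪A ‖x - x₀‖, x - x₀⟫ / ‖x - x₀‖ + R ‖x - x₀‖) z) x) (x - x₀)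
          = cross (gradient (fun z => ⟪u z, z - x₀⟫) x)
              (gradient (fun x => ⟪A ‖x - x₀‖, x - x₀⟫ / ‖x - x₀‖ + R ‖x - x₀‖) x)) →
      ∀ r > 0, A r = 0 :=
  dipoleNeverSteady_of_fluxStarvationSteady fluxStarvationSteady

end Summit.NavierStokesRegularity.NavierStokesRegularity.Theorems.PoloidalLiouville.FluxStarvedDipole

end
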